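import Mathlib.RingTheory.DiscreteValuationRing.Basic
import Mathlib.RingTheory.AdicCompletion.Noetherian
import Mathlib.RingTheory.Nakayama
import Mathlib.Algebra.Module.Submodule.Pointwise
import HarnessLib

/-!
# (θ1) Lattice homothety over a DVR: commensurable `G`-stable lattices, one residually irreducible,
# are homothetic — the «next checkable statement» of card `character-side-signed-transport`, PROVED

Route `ResidualThetaTransportAtTwo` (RTT), crux (R≥)ᵖ `ResidualThetaCountLowerPureAtTwo`
(stmt-BirchSwinnertonDyer-26074); seat `prover-bsd-wall-rtt-p2` g11 (`--supports`, closes nothing).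
HONEST FRAMING: THEOREMS ONLY (no definition, no named fact, no instance, no `sorry`); pure commutative
algebra; BSD is not proved by any of this.

This is the `def LatticeHomothety : Prop` (θ1) of `Cruxes/ResidualThetaCountLowerPureAtTwo/Sketch_cruxidea2_g5.lean`
(crux-ideate #2 r1g5; triage round 1 passes the θ-line first), proved with the SAME binders and conclusion,
character for character (`latticeHomothety`). Role in the line of record (LINE-DESIGN-g11 §2 (U),
THETA-LINE-ideator2-r1g5 θ1): it is the algebra making the local isomorphism
`θ : T_g|_{G_ℚ₂} ≅ T₂W ⊗ 𝒪_λ` unique up to `𝒪_λˣ` (indeed automatic) once the RATIONAL representations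
agree — two commensurable `G`-stable lattices `T, T'` over a DVR with `T/𝔪T` irreducible satisfy
`T' = c•T` or `T = c•T'`.

Proof (Serre's argument). Scale: `S = a•T' ≤ T`, `S ≠ 0`. By Krull (`T` finitely generated over the
Noetherian local `O`) there is a largest `n` with `S ≤ ϖⁿT`. Put `U = {x ∈ T : ϖⁿx ∈ S}`; then `ϖⁿU = S`,
`U` is `G`-stable and `U ⊄ 𝔪T`. Residual irreducibility applied to `N = U + 𝔪T` gives `U + 𝔪T = T`,
Nakayama gives `U = T`, so `a•T' = ϖⁿ•T`; writing `a = u·ϖᵐ` and cancelling (`V` torsion-free) yields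
`T' = (u⁻¹ϖ^{n−m})•T` or `(uϖ^{m−n})•T' = T`.

* helpers: `pointwise_smul_cancel` (`r ≠ 0`, `r•A = r•B ⇒ A = B`), `pointwise_smul_mono`,
  `eq_bot_of_forall_le_pow_smul` (Krull, transported from `↥T` to `V`);
* **`latticeHomothety`** — the Prop (θ1) verbatim.

References: [SerreAbelianLadic1968] I §1.1 (lattices; residually irreducible ⇒ homothetic, Exercise);
[Washington1997] §13.2; Matsumura Thm. 8.10 (Krull).
-/

set_option autoImplicit false
-- the Theorems namespace of this sub repeats the summit name by design (D-0017 nested layout)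
set_option linter.dupNamespace false

noncomputable section

open scoped Pointwise

namespace Summit.BirchSwinnertonDyer.BirchSwinnertonDyer.Theorems.ThetaTransport

section Helpers

variable {O : Type*} [CommRing O] {V : Type*} [AddCommGroup V] [Module O V]

/-- `r•A ≤ r•B ⇒ A ≤ B` for `r` a non-zero-divisor on the torsion-free module `V`. [folklore] -/
theorem le_of_pointwise_smul_le [NoZeroSMulDivisors O V] {r : O} (hr : r ≠ 0) {A B : Submodule O V}
    (h : r • A ≤ r • B) : A ≤ B := by
  intro x hx
  have hx' : r • x ∈ r • B := h (Submodule.smul_mem_pointwise_smul x r A hx)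
  obtain ⟨y, hy, hxy⟩ := (Submodule.mem_smul_pointwise_iff_exists _ _ _).1 hx'
  have hyx : y = x := by
    have h0 : r • (y - x) = 0 := by rw [smul_sub, hxy, sub_self]
    exact sub_eq_zero.1 ((eq_zero_or_eq_zero_of_smul_eq_zero h0).resolve_left hr)
  rw [← hyx]
  exact hy

/-- `r•A = r•B ⇒ A = B` (cancellation) on a torsion-free module. [folklore] -/
theorem pointwise_smul_cancel [NoZeroSMulDivisors O V] {r : O} (hr : r ≠ 0) {A B : Submodule O V}
    (h : r • A = r • B) : A = B :=
  le_antisymm (le_of_pointwise_smul_le hr h.le) (le_of_pointwise_smul_le hr h.ge)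

/-- Monotonicity of `r • ·` on submodules. [folklore] -/
theorem pointwise_smul_mono (r : O) {A B : Submodule O V} (h : A ≤ B) : r • A ≤ r • B := by
  intro x hx
  obtain ⟨y, hy, rfl⟩ := (Submodule.mem_smul_pointwise_iff_exists _ _ _).1 hx
  exact Submodule.smul_mem_pointwise_smul y r B (h hy)

/-- **Krull's intersection theorem for a finitely generated submodule of an ambient module**: over a
Noetherian local ring, `x ∈ ϖⁿ•T` for all `n` (with `ϖ ∈ 𝔪`) and `x ∈ T` force `x = 0`.
[cite: Matsumura1987, Theorem 8.10] -/
theorem eq_zero_of_forall_mem_pow_smul [IsNoetherianRing O] [IsLocalRing O] {ϖ : O}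
    (hϖ : ϖ ∈ IsLocalRing.maximalIdeal O) {T : Submodule O V} (hT : T.FG) {x : V} (hx : x ∈ T)
    (h : ∀ n : ℕ, x ∈ (ϖ ^ n) • T) : x = 0 := by
  haveI : Module.Finite O T := Module.Finite.iff_fg.mpr hT
  have key : ∀ n : ℕ, (⟨x, hx⟩ : T) ≡ 0 [SMOD ((IsLocalRing.maximalIdeal O) ^ n • ⊤ : Submodule O T)] := by
    intro n
    rw [SModEq.zero]
    obtain ⟨y, hy, hxy⟩ := (Submodule.mem_smul_pointwise_iff_exists _ _ _).1 (h n)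
    have : (⟨x, hx⟩ : T) = (ϖ ^ n) • (⟨y, hy⟩ : T) := Subtype.ext hxy.symm
    rw [this]
    exact Submodule.smul_mem_smul (Ideal.pow_mem_pow hϖ n) Submodule.mem_top
  have h0 := IsHausdorff.haus (inferInstance : IsHausdorff (IsLocalRing.maximalIdeal O) T) _ key
  exact congrArg Subtype.val h0

end Helpers

-- the verbatim card statement carries both `[IsDomain O]` (a parameter of `IsDiscreteValuationRing`)
-- and `[IsDiscreteValuationRing O]`; the overlap linter's suggestion (drop one) is impossible here.
set_option linter.overlappingInstances false in
/-- **(θ1) Lattice homothety** — VERBATIM the Prop `LatticeHomothety` of `Sketch_cruxidea2_g5.lean`: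
over a discrete valuation ring `O`, inside a torsion-free `O`-module `V` with an `O`-linear action of a
monoid `G`, two finitely generated, `G`-stable, commensurable submodules `T, T'`, with `T` residually
irreducible (the only `G`-stable submodules between `𝔪T` and `T` are `𝔪T` and `T`), are homothetic:
`c•T = T'` or `c•T' = T` for some `c ≠ 0`.
[cite: SerreAbelianLadic1968, I §1.1 (lattices and homotheties)] -/
theorem latticeHomothety :
    ∀ (O : Type) [CommRing O] [IsDomain O] [IsDiscreteValuationRing O]
      (V : Type) [AddCommGroup V] [Module O V] [NoZeroSMulDivisors O V]
      (G : Type) [Monoid G] [DistribMulAction G V] [SMulCommClass G O V]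
      (T T' : Submodule O V),
      T.FG → T'.FG → T ≠ ⊥ →
      (∀ g : G, ∀ x ∈ T, g • x ∈ T) → (∀ g : G, ∀ x ∈ T', g • x ∈ T') →
      (∃ a : O, a ≠ 0 ∧ a • T' ≤ T) → (∃ b : O, b ≠ 0 ∧ b • T ≤ T') →
      (∀ N : Submodule O V, IsLocalRing.maximalIdeal O • T ≤ N → N ≤ T →
          (∀ g : G, ∀ x ∈ N, g • x ∈ N) → N = IsLocalRing.maximalIdeal O • T ∨ N = T) →
      ∃ c : O, c ≠ 0 ∧ (c • T = T' ∨ c • T' = T) := by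
  intro O _ _ _ V _ _ _ G _ _ _ T T' hT hT' hT0 hGT hGT' ha hb hirr
  obtain ⟨a, ha0, haT⟩ := ha
  obtain ⟨b, hb0, hbT⟩ := hb
  obtain ⟨ϖ, hϖ⟩ := IsDiscreteValuationRing.exists_irreducible O
  have hmax : IsLocalRing.maximalIdeal O = Ideal.span {ϖ} :=
    (IsDiscreteValuationRing.irreducible_iff_uniformizer ϖ).1 hϖ
  have hϖmem : ϖ ∈ IsLocalRing.maximalIdeal O := by
    rw [hmax]; exact Ideal.mem_span_singleton_self ϖ
  have hϖ0 : ϖ ≠ 0 := hϖ.ne_zero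
  have hmT : IsLocalRing.maximalIdeal O • T = ϖ • T := by
    rw [hmax, Submodule.ideal_span_singleton_smul]
  -- `S = a • T'`, a non-zero `G`-stable submodule of `T`
  set S : Submodule O V := a • T' with hS
  have hS0 : S ≠ ⊥ := by
    intro h
    apply hT0
    rw [eq_bot_iff]
    intro x hx
    have h1 : a • (b • x) ∈ S := Submodule.smul_mem_pointwise_smul _ a T'
      (hbT (Submodule.smul_mem_pointwise_smul x b T hx))
    rw [h, Submodule.mem_bot, smul_smul] at h1
    exact (smul_eq_zero.1 h1).resolve_left (mul_ne_zero ha0 hb0)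
  -- the largest `n` with `S ≤ ϖⁿ • T`
  have hex : ∃ m : ℕ, ¬ S ≤ (ϖ ^ m) • T := by
    by_contra hall
    push Not at hall
    apply hS0
    rw [eq_bot_iff]
    intro s hs
    rw [Submodule.mem_bot]
    exact eq_zero_of_forall_mem_pow_smul hϖmem hT (haT hs) fun n => hall n hs
  classical
  let m := Nat.find hex
  have hm : ¬ S ≤ (ϖ ^ m) • T := Nat.find_spec hex
  have hm0 : m ≠ 0 := by
    intro h0
    apply hm
    rw [h0, pow_zero, one_smul]
    exact haT
  obtain ⟨n, hn⟩ : ∃ n, m = n + 1 := Nat.exists_eq_succ_of_ne_zero hm0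
  have hSn : S ≤ (ϖ ^ n) • T := by
    have := Nat.find_min hex (show n < m by omega)
    push Not at this
    exact this
  have hSn1 : ¬ S ≤ (ϖ ^ (n + 1)) • T := hn ▸ hm
  -- `U = {x ∈ T | ϖⁿ x ∈ S}`
  let U : Submodule O V := T ⊓ S.comap (LinearMap.lsmul O V (ϖ ^ n))
  have hUT : U ≤ T := inf_le_left
  have hU : (ϖ ^ n) • U = S := by
    refine le_antisymm ?_ ?_
    · intro x hx
      obtain ⟨y, hy, rfl⟩ := (Submodule.mem_smul_pointwise_iff_exists _ _ _).1 hx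
      exact hy.2
    · intro s hs
      obtain ⟨t, ht, rfl⟩ := (Submodule.mem_smul_pointwise_iff_exists _ _ _).1 (hSn hs)
      exact Submodule.smul_mem_pointwise_smul t _ U ⟨ht, hs⟩
  have hGS : ∀ g : G, ∀ x ∈ S, g • x ∈ S := by
    intro g x hx
    obtain ⟨y, hy, rfl⟩ := (Submodule.mem_smul_pointwise_iff_exists _ _ _).1 hx
    rw [smul_comm]
    exact Submodule.smul_mem_pointwise_smul _ a T' (hGT' g y hy)
  have hGU : ∀ g : G, ∀ x ∈ U, g • x ∈ U := by
    intro g x hx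
    refine ⟨hGT g x hx.1, ?_⟩
    change (ϖ ^ n) • (g • x) ∈ S
    rw [← smul_comm g (ϖ ^ n) x]
    exact hGS g _ hx.2
  have hUnot : ¬ U ≤ ϖ • T := by
    intro hle
    apply hSn1
    rw [← hU, pow_succ, mul_smul]
    exact pointwise_smul_mono _ hle
  -- residual irreducibility: `U + 𝔪T = T`
  have hGN : ∀ g : G, ∀ x ∈ U ⊔ IsLocalRing.maximalIdeal O • T,
      g • x ∈ U ⊔ IsLocalRing.maximalIdeal O • T := by
    intro g x hx
    obtain ⟨u, hu, w, hw, rfl⟩ := Submodule.mem_sup.1 hx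
    rw [smul_add]
    refine Submodule.add_mem_sup (hGU g u hu) ?_
    rw [hmT] at hw ⊢
    obtain ⟨t, ht, rfl⟩ := (Submodule.mem_smul_pointwise_iff_exists _ _ _).1 hw
    rw [smul_comm]
    exact Submodule.smul_mem_pointwise_smul _ ϖ T (hGT g t ht)
  have hN : U ⊔ IsLocalRing.maximalIdeal O • T = T := by
    rcases hirr (U ⊔ IsLocalRing.maximalIdeal O • T) le_sup_right
        (sup_le hUT Submodule.smul_le_right) hGN with h | h
    · exfalso
      apply hUnot
      rw [← hmT]
      exact le_sup_left.trans h.le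
    · exact h
  have hUeq : U = T :=
    le_antisymm hUT (Submodule.le_of_le_smul_of_le_jacobson_bot hT
      (IsLocalRing.maximalIdeal_le_jacobson _) hN.ge)
  -- `a • T' = ϖⁿ • T`
  have hmain : a • T' = (ϖ ^ n) • T := by rw [← hUeq, hU]
  obtain ⟨k, u, hau⟩ := IsDiscreteValuationRing.eq_unit_mul_pow_irreducible ha0 hϖ
  rcases le_or_gt k n with hkn | hkn
  · -- `T' = (u⁻¹ ϖ^{n-k}) • T`
    refine ⟨↑u⁻¹ * ϖ ^ (n - k), mul_ne_zero (Units.ne_zero _) (pow_ne_zero _ hϖ0), Or.inl ?_⟩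
    have h1 : (ϖ ^ k) • ((u : O) • T') = (ϖ ^ k) • ((ϖ ^ (n - k)) • T) := by
      rw [← mul_smul, ← mul_smul, mul_comm, ← hau, ← pow_add, Nat.add_sub_cancel' hkn, hmain]
    have h2 := pointwise_smul_cancel (pow_ne_zero _ hϖ0) h1
    rw [mul_smul, ← h2, ← mul_smul, Units.inv_mul, one_smul]
  · -- `(u ϖ^{k-n}) • T' = T`
    refine ⟨↑u * ϖ ^ (k - n), mul_ne_zero (Units.ne_zero _) (pow_ne_zero _ hϖ0), Or.inr ?_⟩
    have h1 : (ϖ ^ n) • ((↑u * ϖ ^ (k - n)) • T') = (ϖ ^ n) • T := by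
      rw [← mul_smul, ← hmain]
      congr 1
      rw [hau]
      rw [mul_left_comm, ← pow_add, Nat.add_sub_cancel' hkn.le]
    exact pointwise_smul_cancel (pow_ne_zero _ hϖ0) h1

end Summit.BirchSwinnertonDyer.BirchSwinnertonDyer.Theorems.ThetaTransport

end
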